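import Literature.NumberTheory.EllipticCurves.UnramifiedLayerTwistedKummerProofs
import HarnessLib

/-!
# Kummer theory with an unramified twist over a RAMIFIED layer: counting
# `α ∈ L^×/(L^×)^{p^m}` with `F(α) ≡ α^e` when `p` is NOT a uniformiser of `L`

`Proofs` file (theorems only: **no definition, no named fact, nothing asserted**) in topic
`NumberTheory/EllipticCurves`, the ramified twin of `UnramifiedLayerTwistedKummerProofs` (R. Greenberg,
*Iwasawa theory for elliptic curves*, LNM 1716 (1999), §2 Prop. 2.2, p. 73: "`H¹(M, C)` has
`ℤ_p`-corank `[M : ℚ_p]`"; §3 Lemma 3.4, p. 89; J.-P. Serre, *Local Fields*, XIV §4, V §3). The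
unramified file proves the abstract twisted Kummer count
`TwistedKummer.exists_finset_forall_frobenius_zpow_rep` for a subfield `L` of a valued field
`(Ω, w)` on which **the prime `p` is a uniformiser** (`|x| < 1 ⇒ |x| ≤ |p|` on `L`) — input (C1) of
the elementary proof of Greenberg's Lemma 3.4 at the layer `n = 0` over `ℚ`
(`CyclotomicLineCocycleCountProofs`, `OrdinaryLocalKummerCountProofs`). At a layer `n ≥ 1` of the
cyclotomic tower the relevant field `L_n = (ℚ_n)_p(ζ_{q^f-1})` is RAMIFIED over `ℚ_p`
(`e = pⁿ`): its uniformiser is `ϖ` with `|ϖ|^e = |p|`. **This file re-proves the abstract count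
with a uniformiser `ϖ ∈ L` in place of `p`** (levels `U_i = {|x - 1| ≤ |ϖ|^i}`, digits
`(u - 1)ϖ^{-i}`, `F ϖ = ϖ`):

* `exists_val_eq_zpow` — the value group of `L` is `|ϖ|^ℤ` (from `|x| < 1 ⇒ |x| ≤ |ϖ|`).
* `exists_pow_prime_eq_of_val_sub_one_le` — **`p`-th roots of deep principal units**,
  `U_{i+e} ⊆ (U_i)^p` for `|ϖ|^i ≤ |p| |ϖ|` (`i ≥ e + 1`): `(1 + ϖ^i a)^p = 1 + p ϖ^i (a + E_i(a))`
  with `E_i` a `|ϖ|`-contraction (`E_i(a) - E_i(a') = (a - a')(S - p)/p`, `|S - p| ≤ |ϖ|^i ≤ |p||ϖ|`);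
  hence `exists_pow_prime_pow_eq_of_val_sub_one_le`: `U_{(e+1) + k e} ⊆ (U_{e+1})^{p^k}`.
* §4 digits `U_i/U_{i+1} ↪ k̄`, `1 + ϖ^i a ↦ ā`, additive, `F ↦ (·)^q` (using `F ϖ = ϖ`),
  `(·)^e ↦ e·(·)`, vanishing iff deeper.
* §5 the level-by-level count (`exists_finset_fibre`, `…_level`, `…_principal_units`, `…_units`) —
  VERBATIM the unramified argument with the level base `ϖ`: `≤ q` classes per level
  (`#ker(a ↦ a^q - e a) ≤ q` on `𝔽_{qⁿ}`), now over `(e + 1) + m e` levels instead of `m + 2`.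
* `exists_finset_forall_frobenius_zpow_rep` — **the twisted Kummer count over a ramified layer**:
  `#R ≤ N · q^{e(m+1)}`, `N = #{0 ≤ i < p^m : p^m ∣ (e' - 1) i}`, such that every `α ∈ L^×` with
  `F(α) α^{-e'} ∈ (L^×)^{p^m}` lies in `r · (L^×)^{p^m}`, `r ∈ R` — the bound
  "`#H¹(L, C[p^m])^{F-twist} ≤ c₀ · q^{e m}`" with the RIGHT exponent `e·m` for a layer of
  ramification index `e` (corank `e · [k_L-part]`, Greenberg Prop. 2.2).

HONEST FRAMING (cell `bsd-f1-sign2`, WIDTH-5 attach seat `bsd-line-att-p5` g41 on crux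
stmt-BirchSwinnertonDyer-22298, lineage successor (i)): step (3) of the route to the Kummer count
(C1ₙ) of Lemma 3.4 at the layers (memo `Cruxes/MainConjectureOfRankZeroBSDAtTwo/LEMMA34-LAYERS-att-p5-g41.md`
§4): pure valued-field algebra; the instantiation for `L_n ⊆ K̄_v` (value group, residue map,
completeness of `L_n`) and the cohomological half on the open subgroup `H_{v,n}` remain; closes no
item; BSD is not proved by any of this.

## References

* [SerreLocalFields1979] J.-P. Serre, *Local Fields*, GTM 67 (1979), IV §4 Prop. 16, V §3,
  XIV §4, X §3.
* [GreenbergLNM1716] R. Greenberg, LNM 1716 (1999), §2 Prop. 2.2 (proof, p. 73), §3 Lemma 3.4.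

## Design

No definitions; `noncomputable section`; one universe `u`; namespace `…TwistedKummerRamified`
(the generic §0–§1 lemmas of `…TwistedKummer` are reused by name). Hypotheses: `ϖ ∈ L`,
`0 < |ϖ| < 1`, `hdisc : |x| < 1 ⇒ |x| ≤ |ϖ|` on `L`, `hpe : |p| = |ϖ|^e`, `F ϖ = ϖ`, and the
residue/completeness data of the unramified file verbatim. Axioms: `propext`, `Classical.choice`,
`Quot.sound`.
-/

noncomputable section

open scoped Classical NNReal
open NumberField IsDedekindDomain

universe u

namespace Literature.NumberTheory.EllipticCurves.TwistedKummerRamified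

open Literature.NumberTheory.EllipticCurves.TwistedKummer

/-- `|n| ≤ 1` for every natural number `n` (ultrametric inequality). [folklore] -/
private theorem val_natCast_le_one {Ω : Type u} [Field Ω] (w : Valuation Ω ℝ≥0) (n : ℕ) :
    w (n : Ω) ≤ 1 := by
  induction n with
  | zero => simp
  | succ n ih =>
    rw [Nat.cast_succ]
    exact (w.map_add _ _).trans (max_le ih (by rw [w.map_one]))

/-! ## §2 The value group of the layer: `|L^×| = |ϖ|^ℤ` -/

section Layer

variable {Ω : Type u} [Field Ω] (w : Valuation Ω ℝ≥0) (L : Subfield Ω) (ϖ : Ω)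
  (hϖL : ϖ ∈ L) (hϖ1 : w ϖ < 1) (hϖ0 : 0 < w ϖ)
  (hdisc : ∀ x ∈ L, w x < 1 → w x ≤ w ϖ)

include hϖL hϖ1 hϖ0 hdisc in
/-- **The value group of the layer is `|ϖ|^ℤ`**: every non-zero `x ∈ L` has `|x| = |ϖ|^m` for an
integer `m` (from `|x| < 1 ⇒ |x| ≤ |ϖ|` on `L`). Serre, *Local Fields*, II §3. [cite: SerreLocalFields1979, Ch. II §3] -/
theorem exists_val_eq_zpow {x : Ω} (hxL : x ∈ L) (hx : x ≠ 0) : ∃ m : ℤ, w x = w ϖ ^ m := by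
  have hx0 : 0 < w x := (Valuation.pos_iff w).mpr hx
  have hρ1 : (1 : ℝ) < ((w ϖ)⁻¹ : ℝ≥0) := by
    rw [NNReal.coe_inv]; exact one_lt_inv₀ (by exact_mod_cast hϖ0) |>.mpr (by exact_mod_cast hϖ1)
  obtain ⟨n, hn1, hn2⟩ := exists_mem_Ioc_zpow (by exact_mod_cast hx0 : (0 : ℝ) < w x) hρ1
  have hpne : (w ϖ) ≠ 0 := hϖ0.ne'
  have h1 : w ϖ ^ (-n) < w x := by
    have : ((w ϖ)⁻¹ : ℝ≥0) ^ n < w x := by exact_mod_cast hn1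
    rwa [inv_zpow'] at this
  have h2 : w x ≤ w ϖ ^ (-(n + 1)) := by
    have : w x ≤ ((w ϖ)⁻¹ : ℝ≥0) ^ (n + 1) := by exact_mod_cast hn2
    rwa [inv_zpow'] at this
  set y : Ω := x * ϖ ^ (n + 1) with hy
  have hϖ0' : ϖ ≠ 0 := fun h ↦ by rw [h, map_zero] at hϖ0; exact lt_irrefl _ hϖ0
  have hyL : y ∈ L := L.mul_mem hxL (L.zpow_mem hϖL _)
  have hwy : w y = w x * w ϖ ^ (n + 1) := by rw [hy, map_mul, map_zpow₀]
  have hy1 : w y ≤ 1 := by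
    rw [hwy]
    calc w x * w ϖ ^ (n + 1) ≤ w ϖ ^ (-(n + 1)) * w ϖ ^ (n + 1) := mul_le_mul' h2 le_rfl
      _ = 1 := by rw [← zpow_add₀ hpne, neg_add_cancel, zpow_zero]
  have hylow : w ϖ < w y := by
    rw [hwy]
    calc w ϖ = w ϖ ^ (-n) * w ϖ ^ (n + 1) := by
          rw [← zpow_add₀ hpne, show -n + (n + 1) = (1 : ℤ) by ring, zpow_one]
      _ < w x * w ϖ ^ (n + 1) := mul_lt_mul_of_pos_right h1 (zpow_pos hϖ0 _)
  have hy_eq : w y = 1 := by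
    rcases hy1.lt_or_eq with hlt | heq
    · exact absurd (hdisc y hyL hlt) (not_le.mpr hylow)
    · exact heq
  refine ⟨-(n + 1), ?_⟩
  have : w x = w y * w ϖ ^ (-(n + 1)) := by
    rw [hwy, mul_assoc, ← zpow_add₀ hpne, add_neg_cancel, zpow_zero, mul_one]
  rw [this, hy_eq, one_mul]

include hϖ1 hϖ0 in
/-- `m ↦ |ϖ|^m` is injective. [cite: SerreLocalFields1979, Ch. II §3] -/
theorem zpow_val_injective : Function.Injective fun m : ℤ ↦ w ϖ ^ m :=
  zpow_right_injective₀ hϖ0 hϖ1.ne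

end Layer

/-! ## §3 `p`-th roots of principal units: `U_{i+e} ⊆ (U_i)^p` for `i ≥ e + 1` -/

section Roots

variable {Ω : Type u} [Field Ω] (w : Valuation Ω ℝ≥0) (L : Subfield Ω) (p : ℕ) (ϖ : Ω)
  (hp0 : 0 < w (p : Ω)) (hϖL : ϖ ∈ L) (hϖ1 : w ϖ < 1) (hϖ0 : 0 < w ϖ)
  (hcomplete : ∀ (ρ : ℝ≥0), ρ < 1 → ∀ x : ℕ → Ω, (∀ r, x r ∈ L) →
    (∀ r, w (x (r + 1) - x r) ≤ ρ ^ (r + 1)) → ∃ y ∈ L, ∀ r, w (y - x r) ≤ ρ ^ (r + 1))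

/-- The binomial error term: `(1 + ϖ^i a)^p = 1 + p ϖ^i (a + E_i(a))` with
`E_i(a) = ((1 + ϖ^i a)^p - 1) (p ϖ^i)⁻¹ - a`. [cite: SerreLocalFields1979, Ch. V §3] -/
theorem one_add_pow_prime_eq (hp0' : (p : Ω) ≠ 0) (hϖ0' : ϖ ≠ 0) (i : ℕ) (a : Ω) :
    (1 + ϖ ^ i * a) ^ p =
      1 + (p : Ω) * ϖ ^ i * (a + (((1 + ϖ ^ i * a) ^ p - 1) * ((p : Ω) * ϖ ^ i)⁻¹ - a)) := by
  have hpi : (p : Ω) * ϖ ^ i ≠ 0 := mul_ne_zero hp0' (pow_ne_zero _ hϖ0')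
  field_simp
  ring

include hϖ1 in
/-- **The error term is a contraction** at a level `i` with `|ϖ|^i ≤ |p| |ϖ|` (`i ≥ e + 1` for
`|p| = |ϖ|^e`): for `|a|, |a'| ≤ 1`, `|E_i(a) - E_i(a')| ≤ |ϖ| · |a - a'|`. Indeed
`(1 + ϖ^i a)^p - (1 + ϖ^i a')^p = ϖ^i (a - a') S` with `S = Σ_{l<p} (1 + ϖ^i a)^l (1 + ϖ^i a')^{p-1-l}`,
`|S - p| ≤ |ϖ|^i`, so `E_i(a) - E_i(a') = (a - a')(S - p)/p` has absolute value
`≤ |a - a'| |ϖ|^i / |p| ≤ |ϖ| |a - a'|`. [cite: SerreLocalFields1979, Ch. V §3] -/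
theorem val_errorTerm_sub_le (hp0' : (p : Ω) ≠ 0) (hϖ0' : ϖ ≠ 0) {i : ℕ}
    (hi : w ϖ ^ i ≤ w (p : Ω) * w ϖ) {a a' : Ω} (ha : w a ≤ 1) (ha' : w a' ≤ 1) :
    w ((((1 + ϖ ^ i * a) ^ p - 1) * ((p : Ω) * ϖ ^ i)⁻¹ - a) -
        (((1 + ϖ ^ i * a') ^ p - 1) * ((p : Ω) * ϖ ^ i)⁻¹ - a')) ≤
      w ϖ * w (a - a') := by
  set P : Ω := (p : Ω) with hP
  set X : Ω := 1 + ϖ ^ i * a with hX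
  set Y : Ω := 1 + ϖ ^ i * a' with hY
  set S : Ω := ∑ l ∈ Finset.range p, X ^ l * Y ^ (p - 1 - l) with hS
  have hgeom : S * (X - Y) = X ^ p - Y ^ p := Commute.geom_sum₂_mul (Commute.all X Y) p
  have hXY : X - Y = ϖ ^ i * (a - a') := by rw [hX, hY]; ring
  have hϖi : ϖ ^ i ≠ 0 := pow_ne_zero _ hϖ0'
  -- the algebraic identity
  have e : ((X ^ p - 1) * (P * ϖ ^ i)⁻¹ - a) - ((Y ^ p - 1) * (P * ϖ ^ i)⁻¹ - a') =
      (a - a') * (S - p) * P⁻¹ := by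
    have h1 : (X ^ p - 1) - (Y ^ p - 1) = S * (ϖ ^ i * (a - a')) := by rw [← hXY, hgeom]; ring
    have h2 : ((X ^ p - 1) * (P * ϖ ^ i)⁻¹ - a) - ((Y ^ p - 1) * (P * ϖ ^ i)⁻¹ - a') =
        ((X ^ p - 1) - (Y ^ p - 1)) * (P * ϖ ^ i)⁻¹ - (a - a') := by ring
    rw [h2, h1]
    field_simp
    ring
  rw [e, map_mul, map_mul, map_inv₀]
  -- `|S - p| ≤ |ϖ|^i`
  have hρi : w ϖ ^ i < 1 := by
    refine lt_of_le_of_lt hi ?_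
    calc w P * w ϖ ≤ 1 * w ϖ := by
          refine mul_le_mul' ?_ le_rfl
          -- `|p| ≤ 1`: `p` is a natural number
          rw [hP]; exact val_natCast_le_one w p
      _ = w ϖ := one_mul _
      _ < 1 := hϖ1
  have hX1 : w (X - 1) ≤ w ϖ ^ i := by
    rw [hX, add_sub_cancel_left, map_mul, map_pow]
    exact mul_le_of_le_one_right' ha
  have hY1 : w (Y - 1) ≤ w ϖ ^ i := by
    rw [hY, add_sub_cancel_left, map_mul, map_pow]
    exact mul_le_of_le_one_right' ha'
  have hSp : w (S - p) ≤ w ϖ ^ i := by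
    have hsum : S - p = ∑ l ∈ Finset.range p, (X ^ l * Y ^ (p - 1 - l) - 1) := by
      rw [Finset.sum_sub_distrib, Finset.sum_const, Finset.card_range, nsmul_eq_mul, mul_one]
    rw [hsum]
    refine Valuation.map_sum_le w fun l _ ↦ ?_
    have h1 := val_pow_sub_one_le w hρi hX1 l
    have h2 := val_pow_sub_one_le w hρi hY1 (p - 1 - l)
    exact val_mul_sub_one_le_of_le w hρi h1 h2
  -- assemble: `|a - a'| |S - p| / |p| ≤ |a - a'| |ϖ|^i / |p| ≤ |ϖ| |a - a'|`
  have hPpos : 0 < w P := lt_of_le_of_ne zero_le (fun h ↦ hp0' ((Valuation.zero_iff w).mp h.symm))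
  calc w (a - a') * w (S - ↑p) * (w P)⁻¹ ≤ w (a - a') * (w P * w ϖ) * (w P)⁻¹ := by
        gcongr
        exact hSp.trans hi
    _ = w ϖ * w (a - a') := by field_simp

include hp0 hϖL hϖ1 hϖ0 hcomplete in
/-- **`p`-th roots of deep principal units** (`U_{i+e} ⊆ (U_i)^p` for `i ≥ e + 1`): if `y ∈ L` has
`|y - 1| ≤ |p| |ϖ|^i` at a level `i` with `|ϖ|^i ≤ |p| |ϖ|`, then `y = x^p` for some `x ∈ L` with
`|x - 1| ≤ |ϖ|^i`. Successive approximation in the complete layer: with `b = (y - 1)/(p ϖ^i)` solve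
`a + E_i(a) = b` by iterating the `|ϖ|`-contraction `a ↦ b - E_i(a)` and put `x = 1 + ϖ^i a`.
Serre, *Local Fields*, V §3 Lemma 2 / XIV §4. [cite: SerreLocalFields1979, Ch. V §3] -/
theorem exists_pow_prime_eq_of_val_sub_one_le {i : ℕ} (hi : w ϖ ^ i ≤ w (p : Ω) * w ϖ) {y : Ω}
    (hyL : y ∈ L) (hy : w (y - 1) ≤ w (p : Ω) * w ϖ ^ i) :
    ∃ x ∈ L, w (x - 1) ≤ w ϖ ^ i ∧ x ^ p = y := by
  set P : Ω := (p : Ω) with hP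
  have hp0' : P ≠ 0 := fun h ↦ by rw [h, map_zero] at hp0; exact lt_irrefl _ hp0
  have hϖ0' : ϖ ≠ 0 := fun h ↦ by rw [h, map_zero] at hϖ0; exact lt_irrefl _ hϖ0
  have hPL : P ∈ L := natCast_mem L p
  have hP1 : w P ≤ 1 := by rw [hP]; exact val_natCast_le_one w p
  have hD : P * ϖ ^ i ≠ 0 := mul_ne_zero hp0' (pow_ne_zero _ hϖ0')
  have hDL : P * ϖ ^ i ∈ L := L.mul_mem hPL (L.pow_mem hϖL i)
  -- the error term and its properties
  let E : Ω → Ω := fun a ↦ ((1 + ϖ ^ i * a) ^ p - 1) * (P * ϖ ^ i)⁻¹ - a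
  have hE0 : E 0 = 0 := by simp [E]
  have hEL : ∀ a ∈ L, E a ∈ L := fun a ha ↦ by
    refine L.sub_mem (L.mul_mem (L.sub_mem (L.pow_mem (L.add_mem L.one_mem
      (L.mul_mem (L.pow_mem hϖL i) ha)) p) L.one_mem) (L.inv_mem hDL)) ha
  have hElip : ∀ a a', w a ≤ 1 → w a' ≤ 1 → w (E a - E a') ≤ w ϖ * w (a - a') :=
    fun a a' ha ha' ↦ val_errorTerm_sub_le w p ϖ hϖ1 hp0' hϖ0' hi ha ha'
  have hEint : ∀ a, w a ≤ 1 → w (E a) ≤ w ϖ := fun a ha ↦ by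
    have := hElip a 0 ha (by rw [map_zero]; exact zero_le_one)
    rw [hE0, sub_zero, sub_zero] at this
    exact this.trans (mul_le_of_le_one_right' ha)
  -- the target `b`
  set b : Ω := (y - 1) * (P * ϖ ^ i)⁻¹ with hb
  have hbL : b ∈ L := L.mul_mem (L.sub_mem hyL L.one_mem) (L.inv_mem hDL)
  have hb1 : w b ≤ 1 := by
    rw [hb, map_mul, map_inv₀, map_mul, map_pow]
    have hpos : 0 < w P * w ϖ ^ i := mul_pos hp0 (pow_pos hϖ0 _)
    calc w (y - 1) * (w P * w ϖ ^ i)⁻¹ ≤ (w P * w ϖ ^ i) * (w P * w ϖ ^ i)⁻¹ := by gcongr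
      _ = 1 := mul_inv_cancel₀ hpos.ne'
  -- the iteration
  obtain ⟨a, ha0, hasucc⟩ : ∃ a : ℕ → Ω, a 0 = b ∧ ∀ n, a (n + 1) = b - E (a n) :=
    ⟨fun n ↦ Nat.rec b (fun _ an ↦ b - E an) n, rfl, fun n ↦ rfl⟩
  have haL : ∀ n, a n ∈ L := fun n ↦ by
    induction n with
    | zero => rw [ha0]; exact hbL
    | succ n ih => rw [hasucc]; exact L.sub_mem hbL (hEL _ ih)
  have haint : ∀ n, w (a n) ≤ 1 := fun n ↦ by
    induction n with
    | zero => rw [ha0]; exact hb1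
    | succ n ih =>
      rw [hasucc]
      exact (Valuation.map_sub w _ _).trans (max_le hb1 ((hEint _ ih).trans hϖ1.le))
  have hdiff : ∀ n, w (a (n + 1) - a n) ≤ w ϖ ^ (n + 1) := fun n ↦ by
    induction n with
    | zero =>
      rw [hasucc, ha0, zero_add, pow_one, sub_sub_cancel_left, Valuation.map_neg]
      exact hEint b hb1
    | succ n ih =>
      rw [hasucc (n + 1), hasucc n,
        show b - E (b - E (a n)) - (b - E (a n)) = -(E (b - E (a n)) - E (a n)) by ring,
        Valuation.map_neg, ← hasucc n]
      refine (hElip _ _ (haint _) (haint _)).trans ?_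
      rw [pow_succ']
      exact mul_le_mul' le_rfl ih
  -- the limit and the fixed point
  obtain ⟨α, hαL, hα⟩ := hcomplete (w ϖ) hϖ1 a haL hdiff
  have hαint : w α ≤ 1 := by
    have h := hα 0
    rw [ha0, zero_add, pow_one] at h
    have : α = (α - b) + b := by ring
    rw [this]
    exact (Valuation.map_add w _ _).trans (max_le (h.trans hϖ1.le) hb1)
  have hfix : α = b - E α := by
    rw [← sub_eq_zero]
    by_contra hne
    have hpos : 0 < w (α - (b - E α)) := (Valuation.pos_iff w).mpr hne
    obtain ⟨n, hn⟩ := exists_pow_lt_of_lt_one hpos hϖ1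
    have hle : w (α - (b - E α)) ≤ w ϖ ^ (n + 2) := by
      have e : α - (b - E α) = (α - a (n + 1)) + (E α - E (a n)) := by rw [hasucc]; ring
      rw [e]
      refine (Valuation.map_add w _ _).trans (max_le (hα (n + 1)) ?_)
      refine (hElip _ _ hαint (haint n)).trans ?_
      rw [show n + 2 = (n + 1) + 1 by ring, pow_succ']
      exact mul_le_mul' le_rfl (hα n)
    have : w ϖ ^ (n + 2) ≤ w ϖ ^ n := pow_le_pow_right_of_le_one' hϖ1.le (by omega)
    exact absurd ((hle.trans this).trans_lt hn) (lt_irrefl _)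
  -- `x = 1 + ϖ^i α`
  refine ⟨1 + ϖ ^ i * α, L.add_mem L.one_mem (L.mul_mem (L.pow_mem hϖL i) hαL), ?_, ?_⟩
  · rw [add_sub_cancel_left, map_mul, map_pow]
    exact mul_le_of_le_one_right' hαint
  · rw [one_add_pow_prime_eq p ϖ hp0' hϖ0' i α]
    change 1 + P * ϖ ^ i * (α + E α) = y
    have hsum : α + E α = b := by linear_combination hfix
    rw [hsum, hb, mul_comm (y - 1), ← mul_assoc, mul_inv_cancel₀ hD, one_mul, add_sub_cancel]

include hp0 hϖL hϖ1 hϖ0 hcomplete in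
/-- **`U_{(e+1) + k e} ⊆ (U_{e+1})^{p^k}`** for `|p| = |ϖ|^e`: an element `y ∈ L` with
`|y - 1| ≤ |ϖ|^{(e+1) + k e}` is a `p^k`-th power of some `x ∈ L` with `|x - 1| ≤ |ϖ|^{e+1}` (iterate
the previous statement at the levels `(e+1) + j e ≥ e + 1`). Serre, *Local Fields*, V §3, XIV §4.
[cite: SerreLocalFields1979, Ch. XIV §4] -/
theorem exists_pow_prime_pow_eq_of_val_sub_one_le {e : ℕ} (hpe : w (p : Ω) = w ϖ ^ e) (k : ℕ)
    {y : Ω} (hyL : y ∈ L) (hy : w (y - 1) ≤ w ϖ ^ (e + 1 + k * e)) :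
    ∃ x ∈ L, w (x - 1) ≤ w ϖ ^ (e + 1) ∧ x ^ p ^ k = y := by
  induction k generalizing y with
  | zero => exact ⟨y, hyL, by simpa using hy, by rw [pow_zero, pow_one]⟩
  | succ k ih =>
    -- the level `i = (e+1) + k e ≥ e + 1`
    have hi : w ϖ ^ (e + 1 + k * e) ≤ w (p : Ω) * w ϖ := by
      rw [hpe, ← pow_succ, show e + 1 + k * e = (e + 1) + k * e from rfl]
      exact pow_le_pow_right_of_le_one' hϖ1.le (by omega)
    have hy' : w (y - 1) ≤ w (p : Ω) * w ϖ ^ (e + 1 + k * e) := by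
      rw [hpe, ← pow_add]
      convert hy using 2
      ring
    obtain ⟨x₁, hx₁L, hx₁, rfl⟩ :=
      exists_pow_prime_eq_of_val_sub_one_le w L p ϖ hp0 hϖL hϖ1 hϖ0 hcomplete hi hyL hy'
    obtain ⟨x, hxL, hx, rfl⟩ := ih hx₁L hx₁
    exact ⟨x, hxL, hx, by rw [pow_succ, pow_mul]⟩

end Roots

/-! ## §4 Digits: `U_i/U_{i+1} ↪ k̄`, `1 + ϖ^i a ↦ ā` -/

section Digits

variable {Ω : Type u} [Field Ω] (w : Valuation Ω ℝ≥0) (L : Subfield Ω) (ϖ : Ω)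
  (hϖL : ϖ ∈ L) (hϖ1 : w ϖ < 1) (hϖ0 : 0 < w ϖ)
  (hdisc : ∀ x ∈ L, w x < 1 → w x ≤ w ϖ)
  {k : Type*} [Field k] (res : Ω → k)
  (hres_add : ∀ x y, w x ≤ 1 → w y ≤ 1 → res (x + y) = res x + res y)
  (hres_lt : ∀ x, w x ≤ 1 → (res x = 0 ↔ w x < 1))

include hϖ0 in
/-- `ϖ ≠ 0`. [folklore] -/
private theorem uniformizer_ne_zero : ϖ ≠ 0 := fun h ↦ by
  rw [h, map_zero] at hϖ0; exact lt_irrefl _ hϖ0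

include hϖ0 in
/-- **Integrality of the digit argument**: `|(u - 1) ϖ^{-i}| ≤ 1` if `|u - 1| ≤ |ϖ|^i`. [cite: SerreLocalFields1979, Ch. IV §2 Prop. 6] -/
theorem val_digitArg_le_one {i : ℕ} {u : Ω} (hu : w (u - 1) ≤ w ϖ ^ i) :
    w ((u - 1) * (ϖ ^ i)⁻¹) ≤ 1 := by
  rw [map_mul, map_inv₀, map_pow]
  have hpos : 0 < w ϖ ^ i := pow_pos hϖ0 _
  calc w (u - 1) * (w ϖ ^ i)⁻¹ ≤ w ϖ ^ i * (w ϖ ^ i)⁻¹ := by gcongr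
    _ = 1 := mul_inv_cancel₀ hpos.ne'

include hϖ0 in
/-- The digit argument in terms of `u`: `u = 1 + ϖ^i · ((u - 1) ϖ^{-i})`. [cite: SerreLocalFields1979, Ch. IV §2 Prop. 6] -/
theorem eq_one_add_pow_mul_digitArg (i : ℕ) (u : Ω) :
    u = 1 + ϖ ^ i * ((u - 1) * (ϖ ^ i)⁻¹) := by
  have := pow_ne_zero i (uniformizer_ne_zero w ϖ hϖ0)
  field_simp
  ring

include hϖ1 hϖ0 hres_add hres_lt in
/-- **Digits are additive**: for `|u - 1|, |u' - 1| ≤ |ϖ|^i` with `i ≥ 1`, the digit of `u u'` is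
the sum of the digits. Serre, *Local Fields*, IV §2 Prop. 6. [cite: SerreLocalFields1979, Ch. IV §2 Prop. 6] -/
theorem res_digitArg_mul {i : ℕ} (hi : 1 ≤ i) {u u' : Ω} (hu : w (u - 1) ≤ w ϖ ^ i)
    (hu' : w (u' - 1) ≤ w ϖ ^ i) :
    res ((u * u' - 1) * (ϖ ^ i)⁻¹) = res ((u - 1) * (ϖ ^ i)⁻¹) + res ((u' - 1) * (ϖ ^ i)⁻¹) := by
  set a : Ω := (u - 1) * (ϖ ^ i)⁻¹ with ha
  set a' : Ω := (u' - 1) * (ϖ ^ i)⁻¹ with ha'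
  have hPi : ϖ ^ i ≠ 0 := pow_ne_zero i (uniformizer_ne_zero w ϖ hϖ0)
  have ha1 : w a ≤ 1 := val_digitArg_le_one w ϖ hϖ0 hu
  have ha'1 : w a' ≤ 1 := val_digitArg_le_one w ϖ hϖ0 hu'
  have e : (u * u' - 1) * (ϖ ^ i)⁻¹ = (a + a') + ϖ ^ i * a * a' := by
    rw [eq_one_add_pow_mul_digitArg w ϖ hϖ0 i u, eq_one_add_pow_mul_digitArg w ϖ hϖ0 i u']
    rw [← ha, ← ha']
    field_simp
    ring
  have hc : w (ϖ ^ i * a * a') < 1 := by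
    rw [map_mul, map_mul, map_pow]
    calc w ϖ ^ i * w a * w a' ≤ w ϖ ^ i * 1 * 1 := by gcongr
      _ = w ϖ ^ i := by rw [mul_one, mul_one]
      _ < 1 := pow_lt_one₀ zero_le hϖ1 (by omega)
  have haa' : w (a + a') ≤ 1 := (Valuation.map_add w _ _).trans (max_le ha1 ha'1)
  rw [e, hres_add _ _ haa' hc.le, hres_add _ _ ha1 ha'1, (hres_lt _ hc.le).mpr hc, add_zero]

include hres_lt in
/-- The digit of `1` is `0`. [cite: SerreLocalFields1979, Ch. IV §2 Prop. 6] -/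
theorem res_digitArg_one (i : ℕ) : res (((1 : Ω) - 1) * (ϖ ^ i)⁻¹) = 0 := by
  rw [sub_self, zero_mul]; exact res_zero w res hres_lt

include hϖ1 hϖ0 hres_add hres_lt in
/-- Digits of inverses: the digit of `u⁻¹` is minus the digit of `u`. [cite: SerreLocalFields1979, Ch. IV §2 Prop. 6] -/
theorem res_digitArg_inv {i : ℕ} (hi : 1 ≤ i) {u : Ω} (hu : w (u - 1) ≤ w ϖ ^ i) :
    res ((u⁻¹ - 1) * (ϖ ^ i)⁻¹) = -res ((u - 1) * (ϖ ^ i)⁻¹) := by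
  have hlt : w (u - 1) < 1 := hu.trans_lt (pow_lt_one₀ zero_le hϖ1 (by omega))
  have hu1 := val_eq_one_of_val_sub_one_lt w hlt
  have hu0 : u ≠ 0 := fun h ↦ by rw [h, map_zero] at hu1; exact zero_ne_one hu1
  have hui : w (u⁻¹ - 1) ≤ w ϖ ^ i := by rwa [val_inv_sub_one w hlt]
  have h := res_digitArg_mul w ϖ hϖ1 hϖ0 res hres_add hres_lt hi hu hui
  rw [mul_inv_cancel₀ hu0, res_digitArg_one w ϖ res hres_lt] at h
  exact (neg_eq_of_add_eq_zero_right h.symm).symm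

include hϖ1 hϖ0 hres_add hres_lt in
/-- Digits of powers: the digit of `u^n` is `n` times the digit of `u`. [cite: SerreLocalFields1979, Ch. IV §2 Prop. 6] -/
theorem res_digitArg_pow {i : ℕ} (hi : 1 ≤ i) {u : Ω} (hu : w (u - 1) ≤ w ϖ ^ i) (n : ℕ) :
    res ((u ^ n - 1) * (ϖ ^ i)⁻¹) = n * res ((u - 1) * (ϖ ^ i)⁻¹) := by
  have hρi : w ϖ ^ i < 1 := pow_lt_one₀ zero_le hϖ1 (by omega)
  induction n with
  | zero => rw [pow_zero, res_digitArg_one w ϖ res hres_lt, Nat.cast_zero, zero_mul]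
  | succ n ih =>
    rw [pow_succ, res_digitArg_mul w ϖ hϖ1 hϖ0 res hres_add hres_lt hi
      (val_pow_sub_one_le w hρi hu n) hu, ih, Nat.cast_succ]
    ring

include hϖ1 hϖ0 hres_add hres_lt in
/-- Digits of integer powers: the digit of `u^e` is `e` times the digit of `u`. [cite: SerreLocalFields1979, Ch. IV §2 Prop. 6] -/
theorem res_digitArg_zpow {i : ℕ} (hi : 1 ≤ i) {u : Ω} (hu : w (u - 1) ≤ w ϖ ^ i) (e : ℤ) :
    res ((u ^ e - 1) * (ϖ ^ i)⁻¹) = e * res ((u - 1) * (ϖ ^ i)⁻¹) := by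
  have hρi : w ϖ ^ i < 1 := pow_lt_one₀ zero_le hϖ1 (by omega)
  rcases Int.eq_nat_or_neg e with ⟨n, rfl | rfl⟩
  · rw [zpow_natCast, res_digitArg_pow w ϖ hϖ1 hϖ0 res hres_add hres_lt hi hu n, Int.cast_natCast]
  · rw [zpow_neg, zpow_natCast, res_digitArg_inv w ϖ hϖ1 hϖ0 res hres_add hres_lt hi
      (val_pow_sub_one_le w hρi hu n),
      res_digitArg_pow w ϖ hϖ1 hϖ0 res hres_add hres_lt hi hu n, Int.cast_neg,
      Int.cast_natCast, neg_mul]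

/-- Digits and a Frobenius fixing `ϖ`: `(F u - 1)ϖ^{-i} = F((u - 1)ϖ^{-i})`. [cite: SerreLocalFields1979, Ch. IV §2 Prop. 6] -/
theorem digitArg_map (F : Ω →+* Ω) (hFϖ : F ϖ = ϖ) (i : ℕ) (u : Ω) :
    (F u - 1) * (ϖ ^ i)⁻¹ = F ((u - 1) * (ϖ ^ i)⁻¹) := by
  rw [map_mul, map_sub, map_one, map_inv₀, map_pow, hFϖ]

include hϖL hϖ1 hϖ0 hdisc hres_lt in
/-- **The digit vanishes iff the unit is deeper**: for `u ∈ L` with `|u - 1| ≤ |ϖ|^i`, the digit of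
`u` is `0` iff `|u - 1| ≤ |ϖ|^{i+1}` (discreteness of `L`). [cite: SerreLocalFields1979, Ch. IV §2 Prop. 6] -/
theorem res_digitArg_eq_zero_iff {i : ℕ} {u : Ω} (huL : u ∈ L) (hu : w (u - 1) ≤ w ϖ ^ i) :
    res ((u - 1) * (ϖ ^ i)⁻¹) = 0 ↔ w (u - 1) ≤ w ϖ ^ (i + 1) := by
  have hϖ0' := uniformizer_ne_zero w ϖ hϖ0
  have hposi : 0 < w ϖ ^ i := pow_pos hϖ0 _
  have haL : (u - 1) * (ϖ ^ i)⁻¹ ∈ L :=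
    L.mul_mem (L.sub_mem huL L.one_mem) (L.inv_mem (L.pow_mem hϖL i))
  rw [hres_lt _ (val_digitArg_le_one w ϖ hϖ0 hu)]
  constructor
  · intro hlt
    have hle := hdisc _ haL hlt
    rw [map_mul, map_inv₀, map_pow] at hle
    rw [pow_succ]
    calc w (u - 1) = w (u - 1) * (w ϖ ^ i)⁻¹ * w ϖ ^ i := by
          rw [inv_mul_cancel_right₀ hposi.ne']
      _ ≤ w ϖ * w ϖ ^ i := mul_le_mul' hle le_rfl
      _ = w ϖ ^ i * w ϖ := mul_comm _ _
  · intro hle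
    rw [map_mul, map_inv₀, map_pow]
    calc w (u - 1) * (w ϖ ^ i)⁻¹ ≤ w ϖ ^ (i + 1) * (w ϖ ^ i)⁻¹ := by gcongr
      _ = w ϖ := by rw [pow_succ, mul_assoc, mul_comm (w ϖ), ← mul_assoc,
          mul_inv_cancel₀ hposi.ne', one_mul]
      _ < 1 := hϖ1

end Digits

/-! ## §5 The twisted-eigen count, level by level (levels `|ϖ|^j`) -/

section Count

variable {Ω : Type u} [Field Ω] (w : Valuation Ω ℝ≥0) (L : Subfield Ω) (p : ℕ) (ϖ : Ω)
  (hp0 : 0 < w (p : Ω)) (hϖL : ϖ ∈ L) (hϖ1 : w ϖ < 1) (hϖ0 : 0 < w ϖ)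
  (hdisc : ∀ x ∈ L, w x < 1 → w x ≤ w ϖ)
  (F : Ω →+* Ω) (hFw : ∀ x, w (F x) = w x) (hFL : ∀ x ∈ L, F x ∈ L) (hFϖ : F ϖ = ϖ)
  {k : Type*} [Field k] (res : Ω → k) (q n : ℕ) (hq : 2 ≤ q) (hn : n ≠ 0)
  (hres_add : ∀ x y, w x ≤ 1 → w y ≤ 1 → res (x + y) = res x + res y)
  (hres_lt : ∀ x, w x ≤ 1 → (res x = 0 ↔ w x < 1))
  (hres_F : ∀ x, w x ≤ 1 → res (F x) = res x ^ q)
  (hres_L : ∀ x ∈ L, w x ≤ 1 → res x ^ q ^ n = res x)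
  (hpow_add : ∀ a b : k, (a + b) ^ q = a ^ q + b ^ q)
  (m : ℕ) (e : ℤ)

include hϖ1 hϖ0 hFw hFϖ hres_add hres_lt hres_F in
/-- **The digit of the twist**: for `|u - 1| ≤ |p|^j` (`j ≥ 1`) the digit of `F(u) u^{-e}` is
`a^q - e a`, `a` the digit of `u`. [cite: SerreLocalFields1979, Ch. IV §2 Prop. 6] -/
theorem res_digitArg_twist {j : ℕ} (hj : 1 ≤ j) {u : Ω} (hu : w (u - 1) ≤ w ϖ ^ j) :
    res ((F u * (u ^ e)⁻¹ - 1) * (ϖ ^ j)⁻¹) =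
      res ((u - 1) * (ϖ ^ j)⁻¹) ^ q - e * res ((u - 1) * (ϖ ^ j)⁻¹) := by
  have hρj : w ϖ ^ j < 1 := pow_lt_one₀ zero_le hϖ1 (by omega)
  have hFu : w (F u - 1) ≤ w ϖ ^ j := by rwa [val_map_sub_one w F hFw]
  have hue : w ((u ^ e)⁻¹ - 1) ≤ w ϖ ^ j := by
    rw [← zpow_neg]; exact val_zpow_sub_one_le w hρj hu _
  rw [res_digitArg_mul w ϖ hϖ1 hϖ0 res hres_add hres_lt hj hFu hue, ← zpow_neg,
    res_digitArg_zpow w ϖ hϖ1 hϖ0 res hres_add hres_lt hj hu, digitArg_map ϖ F hFϖ j u,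
    hres_F _ (val_digitArg_le_one w ϖ hϖ0 hu), Int.cast_neg, neg_mul, ← sub_eq_add_neg]

include hϖL hϖ1 hϖ0 hdisc hFw hFL hFϖ hq hn hres_add hres_lt hres_F hres_L hpow_add in
/-- **The fibre step.** Fix `j ≥ 1` and a principal unit `r ∈ L`. Among the principal units
`ε ∈ L` with `F(ε) ε^{-e} ∈ U_{j+1} P` (`P` the `p^m`-th powers of units of `L`) which are
`≡ r (mod U_j P)`, there are at most `q` classes modulo `U_{j+1} P`: normalising `ε r⁻¹` into
`U_j` by an element of `P`, its digit `a` has `(a - a₀)^q - e (a - a₀) ∈ Δ_j` (the digits of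
`P ∩ U_j`) for a fixed `a₀`, and the cosets of `Δ_j` containing such `a - a₀` number at most
`#ker(a ↦ a^q - e a) ≤ q` (`exists_finset_rep_of_map_mem` in `𝔽_{qⁿ}`). Serre, *Local Fields*,
XIV §4 (the filtration of `K^×/K^{×n}`). [cite: SerreLocalFields1979, Ch. XIV §4] -/
theorem exists_finset_fibre {j : ℕ} (hj : 1 ≤ j) {r : Ω} (hrL : r ∈ L) (hr : w (r - 1) ≤ w ϖ) :
    ∃ T : Finset Ω, T.card ≤ q ∧ (∀ t ∈ T, t ∈ L ∧ w (t - 1) ≤ w ϖ) ∧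
      ∀ ε : Ω, ε ∈ L → w (ε - 1) ≤ w ϖ →
        (∃ π : Ω, (∃ γ ∈ L, w γ = 1 ∧ γ ^ p ^ m = π) ∧
          w (F ε * (ε ^ e)⁻¹ * π⁻¹ - 1) ≤ w ϖ ^ (j + 1)) →
        (∃ π : Ω, (∃ γ ∈ L, w γ = 1 ∧ γ ^ p ^ m = π) ∧ w (ε * r⁻¹ * π⁻¹ - 1) ≤ w ϖ ^ j) →
          ∃ t ∈ T, ∃ π : Ω, (∃ γ ∈ L, w γ = 1 ∧ γ ^ p ^ m = π) ∧
            w (ε * t⁻¹ * π⁻¹ - 1) ≤ w ϖ ^ (j + 1) := by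
  -- notation and basic facts
  set P : Ω := ϖ with hPdef
  have hp0' : P ≠ 0 := uniformizer_ne_zero w ϖ hϖ0
  have hPL : P ∈ L := hϖL
  have hρj : w P ^ j < 1 := pow_lt_one₀ zero_le hϖ1 (by omega)
  have hρj1 : w P ^ (j + 1) < 1 := pow_lt_one₀ zero_le hϖ1 (by omega)
  have hρjj : w P ^ (j + 1) ≤ w P ^ j := pow_le_pow_right_of_le_one' hϖ1.le (by omega)
  have hr1 : w (r - 1) < 1 := hr.trans_lt hϖ1
  have hr0 : r ≠ 0 := fun h ↦ by
    have := val_eq_one_of_val_sub_one_lt w hr1; rw [h, map_zero] at this; exact zero_ne_one this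
  -- abbreviations (propositions)
  let IsPk : Ω → Prop := fun π ↦ ∃ γ ∈ L, w γ = 1 ∧ γ ^ p ^ m = π
  let dig : Ω → k := fun u ↦ res ((u - 1) * (P ^ j)⁻¹)
  have hPk1 : ∀ {π}, IsPk π → w π = 1 ∧ π ∈ L ∧ π ≠ 0 := fun hπ ↦ val_eq_one_of_isPk w L p m hπ
  -- (Y) the finite additive group `{a : a^{qⁿ} = a}`
  let Y : AddSubgroup k :=
    { carrier := {a | a ^ q ^ n = a}
      zero_mem' := by simp [zero_pow (pow_ne_zero n (by omega : q ≠ 0))]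
      add_mem' := fun {a b} ha hb ↦ by
        simp only [Set.mem_setOf_eq] at ha hb ⊢
        rw [pow_pow_add q hpow_add, ha, hb]
      neg_mem' := fun {a} ha ↦ by
        simp only [Set.mem_setOf_eq] at ha ⊢
        rw [neg_pow_pow q hq hpow_add, ha] }
  have hYmem : ∀ a : k, a ∈ Y ↔ a ^ q ^ n = a := fun a ↦ Iff.rfl
  haveI : Finite Y := by
    have hqn : 1 < q ^ n := Nat.one_lt_pow hn (by omega)
    have hfin : Set.Finite {a : k | a ^ q ^ n = a} := by
      refine (((Polynomial.X ^ q ^ n - Polynomial.X : Polynomial k)).roots.toFinset.finite_toSet).subset ?_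
      intro a ha
      simp only [Set.mem_setOf_eq] at ha
      simp only [Finset.mem_coe, Multiset.mem_toFinset]
      rw [Polynomial.mem_roots (FiniteField.X_pow_card_sub_X_ne_zero k hqn), Polynomial.IsRoot,
        Polynomial.eval_sub, Polynomial.eval_pow, Polynomial.eval_X, ha, sub_self]
    exact Set.Finite.to_subtype hfin
  -- (T) the twisted Frobenius on `Y`
  let T : Y →+ Y :=
    { toFun := fun y ↦ ⟨(y : k) ^ q - e * y, (hYmem _).mpr (twistMap_mem q n hq hpow_add e y.2)⟩
      map_zero' := Subtype.ext (by simp [zero_pow (by omega : q ≠ 0)])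
      map_add' := fun a b ↦ Subtype.ext (by
        simp only [AddSubgroup.coe_add, AddMemClass.mk_add_mk]
        rw [hpow_add]; ring) }
  have hT : ∀ y : Y, ((T y : Y) : k) = (y : k) ^ q - e * y := fun y ↦ rfl
  -- `#ker T ≤ q`
  have hkerT : Nat.card T.ker ≤ q := by
    let f : Polynomial k := Polynomial.X ^ q - Polynomial.C (e : k) * Polynomial.X
    have hf : f ≠ 0 := by
      intro h
      have := congrArg Polynomial.natDegree h
      rw [Polynomial.natDegree_zero] at this
      have hdeg : f.natDegree = q := by
        rw [Polynomial.natDegree_sub_eq_left_of_natDegree_lt, Polynomial.natDegree_X_pow]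
        rw [Polynomial.natDegree_X_pow]
        refine (Polynomial.natDegree_C_mul_le _ _).trans_lt ?_
        rw [Polynomial.natDegree_X]; omega
      omega
    let ι : T.ker → f.roots.toFinset := fun y ↦ ⟨((y : Y) : k), by
      rw [Multiset.mem_toFinset, Polynomial.mem_roots hf, Polynomial.IsRoot]
      have hy : T y = 0 := y.2
      have hy' : ((y : Y) : k) ^ q - e * ((y : Y) : k) = 0 := by
        rw [← hT]; exact congrArg Subtype.val hy
      simp [f, hy']⟩
    have hι : Function.Injective ι := fun a b h ↦
      Subtype.ext (Subtype.ext (congrArg Subtype.val h :))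
    calc Nat.card T.ker ≤ Nat.card f.roots.toFinset := Nat.card_le_card_of_injective ι hι
      _ = f.roots.toFinset.card := Nat.card_eq_finsetCard _
      _ ≤ Multiset.card f.roots := Multiset.toFinset_card_le _
      _ ≤ f.natDegree := Polynomial.card_roots' f
      _ ≤ q := by
          refine (Polynomial.natDegree_sub_le _ _).trans (max_le ?_ ?_)
          · rw [Polynomial.natDegree_X_pow]
          · refine (Polynomial.natDegree_C_mul_le _ _).trans ?_
            rw [Polynomial.natDegree_X]; omega
  -- level-`j` facts about the digit map `dig`
  have hdig_mem : ∀ u ∈ L, w (u - 1) ≤ w P ^ j → dig u ∈ Y := fun u huL hu ↦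
    (hYmem _).mpr (hres_L _ (L.mul_mem (L.sub_mem huL L.one_mem)
      (L.inv_mem (L.pow_mem hPL j))) (val_digitArg_le_one w ϖ hϖ0 hu))
  have hdig_mul : ∀ {u u'}, w (u - 1) ≤ w P ^ j → w (u' - 1) ≤ w P ^ j →
      dig (u * u') = dig u + dig u' := fun hu hu' ↦
    res_digitArg_mul w ϖ hϖ1 hϖ0 res hres_add hres_lt hj hu hu'
  have hdig_inv : ∀ {u}, w (u - 1) ≤ w P ^ j → dig u⁻¹ = -dig u := fun hu ↦
    res_digitArg_inv w ϖ hϖ1 hϖ0 res hres_add hres_lt hj hu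
  have hdig_zero : ∀ {u}, u ∈ L → w (u - 1) ≤ w P ^ j → (dig u = 0 ↔ w (u - 1) ≤ w P ^ (j + 1)) :=
    fun huL hu ↦ res_digitArg_eq_zero_iff w L ϖ hϖL hϖ1 hϖ0 hdisc res hres_lt huL hu
  have hdig_twist : ∀ {u}, w (u - 1) ≤ w P ^ j →
      dig (F u * (u ^ e)⁻¹) = dig u ^ q - e * dig u := fun hu ↦
    res_digitArg_twist w ϖ hϖ1 hϖ0 F hFw hFϖ res q hres_add hres_lt hres_F e hj hu
  have hU_mul : ∀ {u u'}, w (u - 1) ≤ w P ^ j → w (u' - 1) ≤ w P ^ j → w (u * u' - 1) ≤ w P ^ j :=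
    fun hu hu' ↦ val_mul_sub_one_le_of_le w hρj hu hu'
  have hU_inv : ∀ {u}, w (u - 1) ≤ w P ^ j → w (u⁻¹ - 1) ≤ w P ^ j := fun hu ↦ by
    rwa [val_inv_sub_one w (hu.trans_lt hρj)]
  have hU_twist : ∀ {u}, w (u - 1) ≤ w P ^ j → w (F u * (u ^ e)⁻¹ - 1) ≤ w P ^ j := fun hu ↦
    val_twist_sub_one_le w F hFw e hρj hu
  have hU_ne : ∀ {u}, w (u - 1) ≤ w P ^ j → u ≠ 0 := fun hu h ↦ by
    have := val_eq_one_of_val_sub_one_lt w (hu.trans_lt hρj)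
    rw [h, map_zero] at this; exact zero_ne_one this
  -- (Δ) the digits of `P ∩ U_j`, an additive subgroup of `Y` stable under `T`
  let Δ : AddSubgroup Y :=
    { carrier := {a | ∃ π : Ω, IsPk π ∧ w (π - 1) ≤ w P ^ j ∧ dig π = (a : k)}
      zero_mem' := ⟨1, isPk_one w L p m, by rw [sub_self, map_zero]; exact zero_le,
        by rw [ZeroMemClass.coe_zero]; exact res_digitArg_one w ϖ res hres_lt j⟩
      add_mem' := by
        rintro a b ⟨π, hπ, hπ1, hπd⟩ ⟨π', hπ', hπ'1, hπ'd⟩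
        exact ⟨π * π', isPk_mul w L p m hπ hπ', hU_mul hπ1 hπ'1, by
          rw [hdig_mul hπ1 hπ'1, hπd, hπ'd, AddSubgroup.coe_add]⟩
      neg_mem' := by
        rintro a ⟨π, hπ, hπ1, hπd⟩
        exact ⟨π⁻¹, isPk_inv w L p m hπ, hU_inv hπ1, by
          rw [hdig_inv hπ1, hπd, AddSubgroup.coe_neg]⟩ }
  have hΔmem : ∀ a : Y, a ∈ Δ ↔ ∃ π : Ω, IsPk π ∧ w (π - 1) ≤ w P ^ j ∧ dig π = (a : k) :=
    fun a ↦ Iff.rfl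
  have hΔT : ∀ a ∈ Δ, T a ∈ Δ := by
    rintro a ⟨π, hπ, hπ1, hπd⟩
    exact ⟨F π * (π ^ e)⁻¹, isPk_twist w L p F hFw hFL m e hπ, hU_twist hπ1, by
      rw [hdig_twist hπ1, hπd, hT]⟩
  -- representatives of `T⁻¹(Δ)` modulo `Δ`
  obtain ⟨Rep, hRep, hRepP⟩ := exists_finset_rep_of_map_mem T Δ hΔT
  -- (A) the digit relation between two admissible `ε, ε'`
  have hsub_pow : ∀ a b : k, (a - b) ^ q = a ^ q - b ^ q := fun a b ↦ by
    have h := neg_pow_pow q hq hpow_add 1 b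
    rw [pow_one] at h
    rw [sub_eq_add_neg, hpow_add, h, ← sub_eq_add_neg]
  have hA : ∀ {ε ε' πc πc' π π' : Ω}, ε ∈ L → ε' ∈ L → IsPk πc → IsPk πc' → IsPk π → IsPk π' →
      w (F ε * (ε ^ e)⁻¹ * πc⁻¹ - 1) ≤ w P ^ (j + 1) →
      w (F ε' * (ε' ^ e)⁻¹ * πc'⁻¹ - 1) ≤ w P ^ (j + 1) →
      w (ε * r⁻¹ * π⁻¹ - 1) ≤ w P ^ j → w (ε' * r⁻¹ * π'⁻¹ - 1) ≤ w P ^ j →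
      ∃ π'' : Ω, IsPk π'' ∧ w (π'' - 1) ≤ w P ^ j ∧
        dig π'' = (dig (ε * r⁻¹ * π⁻¹) ^ q - e * dig (ε * r⁻¹ * π⁻¹)) -
          (dig (ε' * r⁻¹ * π'⁻¹) ^ q - e * dig (ε' * r⁻¹ * π'⁻¹)) := by
    intro ε ε' πc πc' π π' hεL hε'L hπc hπc' hπ hπ' hc hc' hu hu'
    obtain ⟨-, hπcL, hπc0⟩ := hPk1 hπc
    obtain ⟨-, hπc'L, hπc'0⟩ := hPk1 hπc'
    obtain ⟨-, hπL, hπ0⟩ := hPk1 hπ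
    obtain ⟨-, hπ'L, hπ'0⟩ := hPk1 hπ'
    have hε0 : ε ≠ 0 := by
      intro h; rw [h, zero_mul, zero_mul, zero_sub, Valuation.map_neg, map_one] at hu
      exact absurd hu (not_le.mpr hρj)
    have hε'0 : ε' ≠ 0 := by
      intro h; rw [h, zero_mul, zero_mul, zero_sub, Valuation.map_neg, map_one] at hu'
      exact absurd hu' (not_le.mpr hρj)
    set u : Ω := ε * r⁻¹ * π⁻¹ with hudef
    set u' : Ω := ε' * r⁻¹ * π'⁻¹ with hu'def
    set uc : Ω := F ε * (ε ^ e)⁻¹ * πc⁻¹ with hucdef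
    set uc' : Ω := F ε' * (ε' ^ e)⁻¹ * πc'⁻¹ with huc'def
    set tw : Ω := F (π' * π⁻¹) * ((π' * π⁻¹) ^ e)⁻¹ with htwdef
    set z : Ω := F (u * u'⁻¹) * ((u * u'⁻¹) ^ e)⁻¹ with hzdef
    have hFε0 : F ε ≠ 0 := (map_ne_zero F).mpr hε0
    have hFε'0 : F ε' ≠ 0 := (map_ne_zero F).mpr hε'0
    have hFr0 : F r ≠ 0 := (map_ne_zero F).mpr hr0
    have hFπ0 : F π ≠ 0 := (map_ne_zero F).mpr hπ0
    have hFπ'0 : F π' ≠ 0 := (map_ne_zero F).mpr hπ'0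
    have huc0 : uc ≠ 0 := hU_ne (hc.trans hρjj)
    have huc'0 : uc' ≠ 0 := hU_ne (hc'.trans hρjj)
    -- the algebraic identity `z = uc uc'⁻¹ · (πc πc'⁻¹ tw)`
    have hz_eq : z = (uc * uc'⁻¹) * (πc * πc'⁻¹ * tw) := by
      have h1 : F ε * (ε ^ e)⁻¹ = uc * πc := by
        rw [hucdef, inv_mul_cancel_right₀ hπc0]
      have h2 : F ε' * (ε' ^ e)⁻¹ = uc' * πc' := by
        rw [huc'def, inv_mul_cancel_right₀ hπc'0]
      have h3 : z = (F ε * (ε ^ e)⁻¹) * (F ε' * (ε' ^ e)⁻¹)⁻¹ * tw := by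
        rw [hzdef, htwdef, hudef, hu'def]
        simp only [map_mul, map_inv₀, mul_zpow, inv_zpow, mul_inv, inv_inv]
        field_simp
      rw [h3, h1, h2]
      field_simp
    have hz : w (z - 1) ≤ w P ^ j := hU_twist (hU_mul hu (hU_inv hu'))
    have hucuc : w (uc * uc'⁻¹ - 1) ≤ w P ^ (j + 1) :=
      val_mul_sub_one_le_of_le w hρj1 hc (by rwa [val_inv_sub_one w (hc'.trans_lt hρj1)])
    have hucucL : uc * uc'⁻¹ ∈ L :=
      L.mul_mem (L.mul_mem (L.mul_mem (hFL ε hεL) (L.inv_mem (L.zpow_mem hεL e)))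
        (L.inv_mem hπcL)) (L.inv_mem (L.mul_mem (L.mul_mem (hFL ε' hε'L)
          (L.inv_mem (L.zpow_mem hε'L e))) (L.inv_mem hπc'L)))
    refine ⟨πc * πc'⁻¹ * tw, isPk_mul w L p m (isPk_mul w L p m hπc (isPk_inv w L p m hπc'))
      (isPk_twist w L p F hFw hFL m e (isPk_mul w L p m hπ' (isPk_inv w L p m hπ))), ?_, ?_⟩
    · have e1 : πc * πc'⁻¹ * tw = z * (uc * uc'⁻¹)⁻¹ := by
        rw [hz_eq, mul_comm (uc * uc'⁻¹) _,
          mul_inv_cancel_right₀ (mul_ne_zero huc0 (inv_ne_zero huc'0))]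
      rw [e1]
      exact hU_mul hz (hU_inv (hucuc.trans hρjj))
    · have e1 : πc * πc'⁻¹ * tw = z * (uc * uc'⁻¹)⁻¹ := by
        rw [hz_eq, mul_comm (uc * uc'⁻¹) _,
          mul_inv_cancel_right₀ (mul_ne_zero huc0 (inv_ne_zero huc'0))]
      have hd0 : dig (uc * uc'⁻¹)⁻¹ = 0 := by
        rw [hdig_inv (hucuc.trans hρjj), neg_eq_zero, hdig_zero hucucL (hucuc.trans hρjj)]
        exact hucuc
      rw [e1, hdig_mul hz (hU_inv (hucuc.trans hρjj)), hd0, add_zero, hzdef,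
        hdig_twist (hU_mul hu (hU_inv hu')), hdig_mul hu (hU_inv hu'), hdig_inv hu', ← sub_eq_add_neg,
        hsub_pow, mul_sub]
      ring
  -- (B) equal digits modulo `Δ` give congruence modulo `U_{j+1} P`
  have hB : ∀ {ε ε' π π' π₅ : Ω}, IsPk π → IsPk π' → IsPk π₅ → ε' ∈ L → ε ∈ L →
      w (ε * r⁻¹ * π⁻¹ - 1) ≤ w P ^ j → w (ε' * r⁻¹ * π'⁻¹ - 1) ≤ w P ^ j →
      w (π₅ - 1) ≤ w P ^ j → dig π₅ = dig (ε * r⁻¹ * π⁻¹) - dig (ε' * r⁻¹ * π'⁻¹) →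
      ∃ π₃ : Ω, IsPk π₃ ∧ w (ε * ε'⁻¹ * π₃⁻¹ - 1) ≤ w P ^ (j + 1) := by
    intro ε ε' π π' π₅ hπ hπ' hπ₅ hε'L hεL hu hu' h5 hd
    obtain ⟨-, hπL, hπ0⟩ := hPk1 hπ
    obtain ⟨-, hπ'L, hπ'0⟩ := hPk1 hπ'
    obtain ⟨-, hπ₅L, hπ₅0⟩ := hPk1 hπ₅
    have hε'0 : ε' ≠ 0 := by
      intro h
      have hu'' := hu'
      rw [h, zero_mul, zero_mul, zero_sub, Valuation.map_neg, map_one] at hu''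
      exact absurd hu'' (not_le.mpr hρj)
    set x : Ω := (ε * r⁻¹ * π⁻¹) * (ε' * r⁻¹ * π'⁻¹)⁻¹ * π₅⁻¹ with hxdef
    have hx : w (x - 1) ≤ w P ^ j := hU_mul (hU_mul hu (hU_inv hu')) (hU_inv h5)
    have hxL : x ∈ L := L.mul_mem (L.mul_mem (L.mul_mem (L.mul_mem hεL (L.inv_mem hrL))
      (L.inv_mem hπL)) (L.inv_mem (L.mul_mem (L.mul_mem hε'L (L.inv_mem hrL))
        (L.inv_mem hπ'L)))) (L.inv_mem hπ₅L)
    have hdx : dig x = 0 := by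
      rw [hxdef, hdig_mul (hU_mul hu (hU_inv hu')) (hU_inv h5), hdig_mul hu (hU_inv hu'),
        hdig_inv hu', hdig_inv h5, hd]
      ring
    have hx1 : w (x - 1) ≤ w P ^ (j + 1) := (hdig_zero hxL hx).mp hdx
    refine ⟨π * π'⁻¹ * π₅, isPk_mul w L p m (isPk_mul w L p m hπ (isPk_inv w L p m hπ')) hπ₅, ?_⟩
    have e1 : ε * ε'⁻¹ * (π * π'⁻¹ * π₅)⁻¹ = x := by
      rw [hxdef]; field_simp
    rwa [e1]
  -- (C) the base point and the representatives
  by_cases hex : ∃ ε₀ πc₀ π₀ : Ω, ε₀ ∈ L ∧ IsPk πc₀ ∧ IsPk π₀ ∧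
      w (F ε₀ * (ε₀ ^ e)⁻¹ * πc₀⁻¹ - 1) ≤ w P ^ (j + 1) ∧ w (ε₀ * r⁻¹ * π₀⁻¹ - 1) ≤ w P ^ j
  swap
  · refine ⟨∅, by simp, by simp, ?_⟩
    rintro ε hεL - ⟨πc, hπc, hc⟩ ⟨π, hπ, hu⟩
    exact absurd ⟨ε, πc, π, hεL, hπc, hπ, hc, hu⟩ hex
  obtain ⟨ε₀, πc₀, π₀, hε₀L, hπc₀, hπ₀, hc₀, hu₀⟩ := hex
  let a₀ : Y := ⟨dig (ε₀ * r⁻¹ * π₀⁻¹), hdig_mem _ (L.mul_mem (L.mul_mem hε₀L (L.inv_mem hrL))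
    (L.inv_mem (hPk1 hπ₀).2.1)) hu₀⟩
  -- the relation `REL ε ρ'`: some normalisation of `ε r⁻¹` has digit `≡ a₀ + ρ' (mod Δ)`
  let REL : Ω → Y → Prop := fun ε ρ' ↦ ∃ π : Ω, ∃ hπ : IsPk π,
    ∃ hu : w (ε * r⁻¹ * π⁻¹ - 1) ≤ w P ^ j, ∃ hεL : ε ∈ L,
      (⟨dig (ε * r⁻¹ * π⁻¹), hdig_mem _ (L.mul_mem (L.mul_mem hεL (L.inv_mem hrL))
        (L.inv_mem (hPk1 hπ).2.1)) hu⟩ : Y) - a₀ - ρ' ∈ Δ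
  -- (C1) every admissible `ε` is related to some representative
  have hC1 : ∀ ε : Ω, ε ∈ L →
      (∃ π : Ω, IsPk π ∧ w (F ε * (ε ^ e)⁻¹ * π⁻¹ - 1) ≤ w P ^ (j + 1)) →
      (∃ π : Ω, IsPk π ∧ w (ε * r⁻¹ * π⁻¹ - 1) ≤ w P ^ j) → ∃ ρ' ∈ Rep, REL ε ρ' := by
    rintro ε hεL ⟨πc, hπc, hc⟩ ⟨π, hπ, hu⟩
    let y : Y := ⟨dig (ε * r⁻¹ * π⁻¹), hdig_mem _ (L.mul_mem (L.mul_mem hεL (L.inv_mem hrL))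
      (L.inv_mem (hPk1 hπ).2.1)) hu⟩ - a₀
    have hy : T y ∈ Δ := by
      obtain ⟨π'', hπ'', h1, hd⟩ := hA hεL hε₀L hπc hπc₀ hπ hπ₀ hc hc₀ hu hu₀
      refine (hΔmem _).mpr ⟨π'', hπ'', h1, ?_⟩
      rw [hd, map_sub, AddSubgroup.coe_sub, hT, hT]
    obtain ⟨ρ', hρ', hyρ⟩ := hRepP y hy
    exact ⟨ρ', hρ', π, hπ, hu, hεL, hyρ⟩
  -- (C2) two `ε` related to the same representative are congruent modulo `U_{j+1} P`
  have hC2 : ∀ {ε ε' : Ω} {ρ' : Y}, REL ε ρ' → REL ε' ρ' →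
      ∃ π₃ : Ω, IsPk π₃ ∧ w (ε * ε'⁻¹ * π₃⁻¹ - 1) ≤ w P ^ (j + 1) := by
    rintro ε ε' ρ' ⟨π, hπ, hu, hεL, hrel⟩ ⟨π', hπ', hu', hε'L, hrel'⟩
    have hdiff := Δ.sub_mem hrel hrel'
    rw [show ∀ a b c : Y, a - a₀ - c - (b - a₀ - c) = a - b by intro a b c; abel] at hdiff
    obtain ⟨π₅, hπ₅, h5, hd⟩ := (hΔmem _).mp hdiff
    rw [AddSubgroup.coe_sub] at hd
    exact hB hπ hπ' hπ₅ hε'L hεL hu hu' h5 hd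
  -- the set `T` of representatives: one admissible `ε` per representative hit
  let g : Y → Ω := fun ρ' ↦
    if h : ∃ ε : Ω, (ε ∈ L ∧ w (ε - 1) ≤ w P) ∧ REL ε ρ' then h.choose else 1
  have hg : ∀ ρ', (g ρ' ∈ L ∧ w (g ρ' - 1) ≤ w P) ∧
      ((∃ ε : Ω, (ε ∈ L ∧ w (ε - 1) ≤ w P) ∧ REL ε ρ') → REL (g ρ') ρ') := by
    intro ρ'
    by_cases h : ∃ ε : Ω, (ε ∈ L ∧ w (ε - 1) ≤ w P) ∧ REL ε ρ'
    · simp only [g, dif_pos h]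
      exact ⟨h.choose_spec.1, fun _ ↦ h.choose_spec.2⟩
    · simp only [g, dif_neg h]
      exact ⟨⟨L.one_mem, by rw [sub_self, map_zero]; exact zero_le⟩, fun h' ↦ absurd h' h⟩
  refine ⟨Rep.image g, (Finset.card_image_le).trans (hRep.trans hkerT), fun t ht ↦ ?_, ?_⟩
  · obtain ⟨ρ', -, rfl⟩ := Finset.mem_image.mp ht
    exact (hg ρ').1
  · intro ε hεL hε1 hcond hequiv
    obtain ⟨ρ', hρ', hrel⟩ := hC1 ε hεL hcond hequiv
    have hrel' : REL (g ρ') ρ' := (hg ρ').2 ⟨ε, ⟨hεL, hε1⟩, hrel⟩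
    obtain ⟨π₃, hπ₃, h3⟩ := hC2 hrel hrel'
    exact ⟨g ρ', Finset.mem_image.mpr ⟨ρ', hρ', rfl⟩, π₃, hπ₃, h3⟩

include hϖL hϖ1 hϖ0 hdisc hFw hFL hFϖ hq hn hres_add hres_lt hres_F hres_L hpow_add in
/-- **Level-by-level count.** For `j ≥ 1` there is a set `R_j ⊆ U_1 ∩ L` with `#R_j ≤ q^{j-1}`
such that every principal unit `ε ∈ L` with `F(ε) ε^{-e} ∈ U_j P` is `≡ r (mod U_j P)` for some
`r ∈ R_j` (induction on `j` with `exists_finset_fibre`). Serre, *Local Fields*, XIV §4.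
[cite: SerreLocalFields1979, Ch. XIV §4] -/
theorem exists_finset_level (j : ℕ) (hj : 1 ≤ j) :
    ∃ R : Finset Ω, R.card ≤ q ^ (j - 1) ∧ (∀ r ∈ R, r ∈ L ∧ w (r - 1) ≤ w ϖ) ∧
      ∀ ε : Ω, ε ∈ L → w (ε - 1) ≤ w ϖ →
        (∃ π : Ω, (∃ γ ∈ L, w γ = 1 ∧ γ ^ p ^ m = π) ∧
          w (F ε * (ε ^ e)⁻¹ * π⁻¹ - 1) ≤ w ϖ ^ j) →
          ∃ r ∈ R, ∃ π : Ω, (∃ γ ∈ L, w γ = 1 ∧ γ ^ p ^ m = π) ∧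
            w (ε * r⁻¹ * π⁻¹ - 1) ≤ w ϖ ^ j := by
  induction j, hj using Nat.le_induction with
  | base =>
    refine ⟨{1}, by simp, fun r hr ↦ ?_, fun ε hεL hε1 _ ↦ ⟨1, Finset.mem_singleton_self _, 1,
      isPk_one w L p m, ?_⟩⟩
    · rw [Finset.mem_singleton] at hr; subst hr
      exact ⟨L.one_mem, by rw [sub_self, map_zero]; exact zero_le⟩
    · rwa [inv_one, mul_one, mul_one, pow_one]
  | succ j hj ih =>
    obtain ⟨R, hRcard, hR, hRcov⟩ := ih
    have hfib : ∀ r : Ω, r ∈ L → w (r - 1) ≤ w ϖ → ∃ T : Finset Ω, T.card ≤ q ∧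
        (∀ t ∈ T, t ∈ L ∧ w (t - 1) ≤ w ϖ) ∧
        ∀ ε : Ω, ε ∈ L → w (ε - 1) ≤ w ϖ →
          (∃ π : Ω, (∃ γ ∈ L, w γ = 1 ∧ γ ^ p ^ m = π) ∧
            w (F ε * (ε ^ e)⁻¹ * π⁻¹ - 1) ≤ w ϖ ^ (j + 1)) →
          (∃ π : Ω, (∃ γ ∈ L, w γ = 1 ∧ γ ^ p ^ m = π) ∧ w (ε * r⁻¹ * π⁻¹ - 1) ≤ w ϖ ^ j) →
            ∃ t ∈ T, ∃ π : Ω, (∃ γ ∈ L, w γ = 1 ∧ γ ^ p ^ m = π) ∧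
              w (ε * t⁻¹ * π⁻¹ - 1) ≤ w ϖ ^ (j + 1) := fun r hrL hr ↦
      exists_finset_fibre w L p ϖ hϖL hϖ1 hϖ0 hdisc F hFw hFL hFϖ res q n hq hn hres_add hres_lt hres_F hres_L hpow_add m e hj hrL hr
    choose Tf hTcard hTmem hTcov using hfib
    let R' : Finset Ω := R.attach.biUnion fun x ↦ Tf x.1 (hR x.1 x.2).1 (hR x.1 x.2).2
    refine ⟨R', ?_, fun t ht ↦ ?_, fun ε hεL hε1 hcond ↦ ?_⟩
    · calc R'.card ≤ ∑ x ∈ R.attach, (Tf x.1 (hR x.1 x.2).1 (hR x.1 x.2).2).card :=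
            Finset.card_biUnion_le
        _ ≤ ∑ _x ∈ R.attach, q := Finset.sum_le_sum fun x _ ↦ hTcard _ _ _
        _ = R.card * q := by rw [Finset.sum_const, Finset.card_attach, smul_eq_mul]
        _ ≤ q ^ (j - 1) * q := Nat.mul_le_mul_right q hRcard
        _ = q ^ (j + 1 - 1) := by
            rw [← pow_succ, show j - 1 + 1 = j + 1 - 1 by omega]
    · obtain ⟨x, -, hx⟩ := Finset.mem_biUnion.mp ht
      exact hTmem _ _ _ t hx
    · obtain ⟨πc, hπc, hc⟩ := hcond
      have hcond' : ∃ π : Ω, (∃ γ ∈ L, w γ = 1 ∧ γ ^ p ^ m = π) ∧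
          w (F ε * (ε ^ e)⁻¹ * π⁻¹ - 1) ≤ w ϖ ^ j :=
        ⟨πc, hπc, hc.trans (pow_le_pow_right_of_le_one' hϖ1.le (by omega))⟩
      obtain ⟨r, hr, hequiv⟩ := hRcov ε hεL hε1 hcond'
      obtain ⟨t, ht, hfin⟩ := hTcov r (hR r hr).1 (hR r hr).2 ε hεL hε1 ⟨πc, hπc, hc⟩ hequiv
      exact ⟨t, Finset.mem_biUnion.mpr ⟨⟨r, hr⟩, Finset.mem_attach _ _, ht⟩, hfin⟩

variable (hcomplete : ∀ (ρ : ℝ≥0), ρ < 1 → ∀ x : ℕ → Ω, (∀ r, x r ∈ L) →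
    (∀ r, w (x (r + 1) - x r) ≤ ρ ^ (r + 1)) → ∃ y ∈ L, ∀ r, w (y - x r) ≤ ρ ^ (r + 1))

variable {d : ℕ} (hpe : w (p : Ω) = w ϖ ^ d)

include hp0 hϖL hϖ1 hϖ0 hdisc hFw hFL hFϖ hq hn hres_add hres_lt hres_F hres_L hpow_add hcomplete hpe in
/-- **The count for principal units.** With `|p| = |ϖ|^d`: there is `R ⊆ U_1 ∩ L` with
`#R ≤ q^{d + m d}` such that every principal unit `ε ∈ L` whose twist `F(ε) ε^{-e}` is a `p^m`-th
power of a unit of `L` lies in `r · P` for some `r ∈ R` (level `(d + 1) + m d` of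
`exists_finset_level`, and `U_{(d+1) + m d} ⊆ P` by `exists_pow_prime_pow_eq_of_val_sub_one_le`).
Serre, *Local Fields*, XIV §4. [cite: SerreLocalFields1979, Ch. XIV §4] -/
theorem exists_finset_principal_units :
    ∃ R : Finset Ω, R.card ≤ q ^ (d + m * d) ∧ (∀ r ∈ R, r ∈ L ∧ w (r - 1) ≤ w ϖ) ∧
      ∀ ε : Ω, ε ∈ L → w (ε - 1) ≤ w ϖ →
        (∃ γ ∈ L, w γ = 1 ∧ γ ^ p ^ m = F ε * (ε ^ e)⁻¹) →
          ∃ r ∈ R, ∃ γ ∈ L, w γ = 1 ∧ γ ^ p ^ m = ε * r⁻¹ := by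
  obtain ⟨R, hRcard, hR, hRcov⟩ := exists_finset_level w L p ϖ hϖL hϖ1 hϖ0 hdisc F hFw hFL hFϖ res q n hq hn hres_add hres_lt hres_F hres_L hpow_add m e (d + 1 + m * d) (by omega)
  refine ⟨R, by rwa [show d + 1 + m * d - 1 = d + m * d by omega] at hRcard, hR, fun ε hεL hε1 hγ ↦ ?_⟩
  have hρ2 : w ϖ ^ (d + 1) < 1 := pow_lt_one₀ zero_le hϖ1 (by omega)
  -- `F(ε) ε^{-e} ∈ P ⊆ U_J P`
  have hx1 : w (F ε * (ε ^ e)⁻¹) = 1 := (val_eq_one_of_isPk w L p m hγ).1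
  have hx0 : F ε * (ε ^ e)⁻¹ ≠ 0 := (val_eq_one_of_isPk w L p m hγ).2.2
  obtain ⟨r, hr, π, hπ, hrπ⟩ := hRcov ε hεL hε1 ⟨F ε * (ε ^ e)⁻¹, hγ, by
    rw [mul_inv_cancel₀ hx0, sub_self, map_zero]; exact zero_le⟩
  obtain ⟨hπ1, hπL, hπ0⟩ := val_eq_one_of_isPk w L p m hπ
  -- `ε r⁻¹ π⁻¹ ∈ U_J ⊆ P`
  have hmemL : ε * r⁻¹ * π⁻¹ ∈ L :=
    L.mul_mem (L.mul_mem hεL (L.inv_mem (hR r hr).1)) (L.inv_mem hπL)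
  obtain ⟨x, hxL, hx2, hxpow⟩ := exists_pow_prime_pow_eq_of_val_sub_one_le w L p ϖ hp0 hϖL hϖ1 hϖ0
    hcomplete hpe m hmemL hrπ
  have hxw : w x = 1 := val_eq_one_of_val_sub_one_lt w (hx2.trans_lt hρ2)
  obtain ⟨γ, hγL, hγ1, hγπ⟩ := hπ
  refine ⟨r, hr, x * γ, L.mul_mem hxL hγL, by rw [map_mul, hxw, hγ1, one_mul], ?_⟩
  rw [mul_pow, hxpow, hγπ, inv_mul_cancel_right₀ hπ0]

variable (hres_mul : ∀ x y, w x ≤ 1 → w y ≤ 1 → res (x * y) = res x * res y) (hpq : p ∣ q)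
  (hprime : p.Prime)

include hdisc hq hres_add hres_lt hres_L hres_mul in
/-- **Units to principal units**: for a unit `ε` of `L`, `ε^{qⁿ-1}` is a principal unit (the
residue of `ε` lies in `𝔽_{qⁿ}^×`). Serre, *Local Fields*, IV §4 Prop. 16.
[cite: SerreLocalFields1979, Ch. IV §4 Prop. 16] -/
theorem val_pow_sub_one_le_of_unit {ε : Ω} (hεL : ε ∈ L) (hε : w ε = 1) :
    w (ε ^ (q ^ n - 1) - 1) ≤ w ϖ := by
  have hε1 : w ε ≤ 1 := hε.le
  have hres0 : res ε ≠ 0 := fun h ↦ by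
    have := (hres_lt ε hε1).mp h; rw [hε] at this; exact lt_irrefl _ this
  have hpow : ∀ j : ℕ, res (ε ^ j) = res ε ^ j := fun j ↦ by
    induction j with
    | zero => rw [pow_zero, pow_zero, res_one w res hres_lt hres_mul]
    | succ j ih =>
      rw [pow_succ, hres_mul _ _ (by rw [map_pow, hε, one_pow]) hε1, ih, pow_succ]
  have hqn1 : 1 ≤ q ^ n := Nat.one_le_pow n q (by omega)
  have hN : res (ε ^ (q ^ n - 1)) = 1 := by
    rw [hpow]
    have h := hres_L ε hεL hε1
    conv_lhs at h => rw [← Nat.sub_add_cancel hqn1, pow_succ]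
    exact (mul_eq_right₀ hres0).mp h
  have hneg1 : res (-1 : Ω) = -1 := by
    have h := hres_add 1 (-1) (by rw [map_one]) (by rw [Valuation.map_neg, map_one])
    rw [add_neg_cancel, res_zero w res hres_lt, res_one w res hres_lt hres_mul] at h
    exact (neg_eq_of_add_eq_zero_right h.symm).symm
  have hval : w (ε ^ (q ^ n - 1)) ≤ 1 := by rw [map_pow, hε, one_pow]
  have hlt : w (ε ^ (q ^ n - 1) - 1) < 1 := by
    have hle : w (ε ^ (q ^ n - 1) - 1) ≤ 1 :=
      (Valuation.map_sub w _ _).trans (max_le hval (by rw [map_one]))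
    rw [← hres_lt _ hle, sub_eq_add_neg, hres_add _ _ hval (by rw [Valuation.map_neg, map_one]),
      hN, hneg1, add_neg_cancel]
  exact hdisc _ (L.sub_mem (L.pow_mem hεL _) L.one_mem) hlt

include hp0 hϖL hϖ1 hϖ0 hdisc hFw hFL hFϖ hq hn hres_add hres_lt hres_F hres_L hpow_add hcomplete hpe
  hres_mul hpq hprime in
/-- **The count for units.** There is `R ⊆ U_1 ∩ L` with `#R ≤ q^{d + m d}` such that every unit
`ε` of `L` whose twist `F(ε) ε^{-e}` is a `p^m`-th power of a unit lies in `r · P` for some `r ∈ R`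
(`ε ≡ (ε^{qⁿ-1})^a (mod P)` with `a(qⁿ - 1) + b p^m = 1`). Serre, *Local Fields*, XIV §4.
[cite: SerreLocalFields1979, Ch. XIV §4] -/
theorem exists_finset_units :
    ∃ R : Finset Ω, R.card ≤ q ^ (d + m * d) ∧ (∀ r ∈ R, r ∈ L ∧ w (r - 1) ≤ w ϖ) ∧
      ∀ ε : Ω, ε ∈ L → w ε = 1 →
        (∃ γ ∈ L, w γ = 1 ∧ γ ^ p ^ m = F ε * (ε ^ e)⁻¹) →
          ∃ r ∈ R, ∃ γ ∈ L, w γ = 1 ∧ γ ^ p ^ m = ε * r⁻¹ := by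
  obtain ⟨R, hRcard, hR, hRcov⟩ := exists_finset_principal_units w L p ϖ hp0 hϖL hϖ1 hϖ0 hdisc F hFw hFL
    hFϖ res q n hq hn hres_add hres_lt hres_F hres_L hpow_add m e hcomplete hpe
  refine ⟨R, hRcard, hR, fun ε hεL hε hγ ↦ ?_⟩
  have hε0 : ε ≠ 0 := fun h ↦ by rw [h, map_zero] at hε; exact zero_ne_one hε
  -- Bezout: `a (qⁿ - 1) + b p^m = 1`
  set N : ℕ := q ^ n - 1 with hNdef
  have hqn1 : 1 ≤ q ^ n := Nat.one_le_pow n q (by omega)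
  have hndvd : ¬ p ∣ N := fun h ↦ by
    have h1 : p ∣ q ^ n := hpq.trans (dvd_pow_self q hn)
    have h2 : p ∣ q ^ n - N := Nat.dvd_sub h1 h
    rw [hNdef, Nat.sub_sub_self hqn1] at h2
    exact hprime.one_lt.ne' (Nat.dvd_one.mp h2)
  have hcop : IsCoprime (N : ℤ) ((p ^ m : ℕ) : ℤ) :=
    Nat.isCoprime_iff_coprime.mpr
      (Nat.Coprime.pow_right _ ((Nat.Prime.coprime_iff_not_dvd hprime).mpr hndvd).symm)
  obtain ⟨a, b, hab⟩ := hcop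
  -- `ε = ε₁ π₁`, `ε₁ = (ε^N)^a` a principal unit, `π₁ = (ε^b)^{p^m} ∈ P`
  set ε₁ : Ω := (ε ^ N) ^ a with hε₁def
  set π₁ : Ω := (ε ^ b) ^ p ^ m with hπ₁def
  have hε₁L : ε₁ ∈ L := L.zpow_mem (L.pow_mem hεL N) a
  have hπ₁ : ∃ γ ∈ L, w γ = 1 ∧ γ ^ p ^ m = π₁ :=
    ⟨ε ^ b, L.zpow_mem hεL b, by rw [map_zpow₀, hε, one_zpow], rfl⟩
  obtain ⟨hπ₁w, hπ₁L, hπ₁0⟩ := val_eq_one_of_isPk w L p m hπ₁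
  have hεeq : ε = ε₁ * π₁ := by
    rw [hε₁def, hπ₁def, ← zpow_natCast (ε ^ b), ← zpow_natCast ε N, ← zpow_mul, ← zpow_mul,
      ← zpow_add₀ hε0, show (N : ℤ) * a + b * ((p ^ m : ℕ) : ℤ) = 1 by rw [← hab]; ring, zpow_one]
  have hε₁1 : w (ε₁ - 1) ≤ w ϖ := by
    rw [hε₁def]
    exact val_zpow_sub_one_le w hϖ1
      (val_pow_sub_one_le_of_unit w L ϖ hdisc res q n hq hres_add hres_lt hres_L hres_mul hεL hε) a
  have hε₁eq : ε₁ = ε * π₁⁻¹ := by rw [hεeq, mul_inv_cancel_right₀ hπ₁0]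
  -- the twist of `ε₁` is again in `P`
  have hγ₁ : ∃ γ ∈ L, w γ = 1 ∧ γ ^ p ^ m = F ε₁ * (ε₁ ^ e)⁻¹ := by
    have h := isPk_mul w L p m hγ (isPk_twist w L p F hFw hFL m e (isPk_inv w L p m hπ₁))
    have e1 : F ε * (ε ^ e)⁻¹ * (F π₁⁻¹ * (π₁⁻¹ ^ e)⁻¹) = F ε₁ * (ε₁ ^ e)⁻¹ := by
      rw [hε₁eq, map_mul, mul_zpow, mul_inv]; ring
    rwa [e1] at h
  obtain ⟨r, hr, γ', hγ'L, hγ'1, hγ'pow⟩ := hRcov ε₁ hε₁L hε₁1 hγ₁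
  refine ⟨r, hr, γ' * ε ^ b, L.mul_mem hγ'L (L.zpow_mem hεL b), by
    rw [map_mul, hγ'1, map_zpow₀, hε, one_zpow, mul_one], ?_⟩
  rw [mul_pow, hγ'pow]
  conv_rhs => rw [hεeq, hπ₁def]
  ring

include hp0 hϖL hϖ1 hϖ0 hdisc hFw hFL hFϖ hq hn hres_add hres_lt hres_F hres_L hpow_add hcomplete hpe
  hres_mul hpq hprime in
/-- **The twisted Kummer count over a ramified layer.** Let `L` be a subfield of the valued field
`(Ω, w)` with a uniformiser `ϖ ∈ L` (`|x| < 1 ⇒ |x| ≤ |ϖ|` on `L`, `0 < |ϖ| < 1`, `|p| = |ϖ|^d`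
for the prime `p`), complete in the sense of `hcomplete`, stable under the isometric ring
endomorphism `F` of `Ω` which FIXES `ϖ`, with a residue map `res` (additive and multiplicative on
integral elements, kernel the elements of valuation `< 1`) such that `res ∘ F = (res ·)^q` and the
residues of `L` lie in `𝔽_{qⁿ}` (`q ≥ 2`, `p ∣ q`). Then for every integer `e` and `m ≥ 0` there
is a finite set `R ⊆ L^×` with `#R ≤ N · q^{d + m d}`, `N = #{0 ≤ i < p^m : p^m ∣ (e - 1) i}`, such
that every `α ∈ L^×` with `F(α) α^{-e} ∈ (L^×)^{p^m}` is `r β^{p^m}` for some `r ∈ R` and `β ∈ L^×`.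
(In the application: `Ω = K̄_v`, `L = (K_n)_v(ζ_{qᶠ-1})` the unramified Teichmüller layer over the
`n`-th layer of a `ℤ_p`-tower totally ramified at `v`, `ϖ ∈ (K_n)_v` a uniformiser, `d = pⁿ`, `F` an
arithmetic Frobenius of `Gal(K̄_v/(K_n)_v)`, `e` the unit root; this bounds
`#H¹((K_n)_v, C[p^m])` by `c₀ · q^{pⁿ m}` for the formal-group torsion `C` of an ordinary curve —
the exponent `[(K_n)_v : ℚ_p] · m` of Greenberg's corank.) Serre, *Local Fields*, XIV §4;
Greenberg, LNM 1716, §2 Prop. 2.2 (p. 73).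
[cite: SerreLocalFields1979, Ch. XIV §4] [cite: GreenbergLNM1716, §2 Prop. 2.2 (proof, p. 73)] -/
theorem exists_finset_forall_frobenius_zpow_rep :
    ∃ R : Finset Ω,
      R.card ≤ ((Finset.range (p ^ m)).filter fun i : ℕ ↦ ((p ^ m : ℕ) : ℤ) ∣ (e - 1) * i).card *
        q ^ (d + m * d) ∧
      (∀ r ∈ R, r ∈ L ∧ r ≠ 0) ∧
      ∀ α : Ω, α ∈ L → α ≠ 0 → (∃ β ∈ L, β ≠ 0 ∧ F α * (α ^ e)⁻¹ = β ^ p ^ m) →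
        ∃ r ∈ R, ∃ β ∈ L, β ≠ 0 ∧ α = r * β ^ p ^ m := by
  obtain ⟨R, hRcard, hR, hRcov⟩ := exists_finset_units w L p ϖ hp0 hϖL hϖ1 hϖ0 hdisc F hFw hFL hFϖ res
    q n hq hn hres_add hres_lt hres_F hres_L hpow_add m e hcomplete hpe hres_mul hpq hprime
  set P : Ω := ϖ with hPdef
  have hp0' : P ≠ 0 := uniformizer_ne_zero w ϖ hϖ0
  have hPL : P ∈ L := hϖL
  have hpm0 : ((p ^ m : ℕ) : ℤ) ≠ 0 := by exact_mod_cast pow_ne_zero m hprime.ne_zero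
  set I : Finset ℕ := (Finset.range (p ^ m)).filter fun i : ℕ ↦ ((p ^ m : ℕ) : ℤ) ∣ (e - 1) * i
    with hIdef
  let f : ℕ × Ω → Ω := fun q' ↦ P ^ q'.1 * q'.2
  refine ⟨(I ×ˢ R).image f, ?_, fun r hr ↦ ?_, fun α hαL hα0 hβ ↦ ?_⟩
  · exact Finset.card_image_le.trans (by rw [Finset.card_product]; exact Nat.mul_le_mul_left _ hRcard)
  · obtain ⟨⟨i, r'⟩, hir, rfl⟩ := Finset.mem_image.mp hr
    rw [Finset.mem_product] at hir
    obtain ⟨hr'L, hr'1⟩ := hR r' hir.2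
    have hr'0 : r' ≠ 0 := fun h ↦ by
      rw [h, zero_sub, Valuation.map_neg, map_one] at hr'1; exact absurd hr'1 (not_le.mpr hϖ1)
    exact ⟨L.mul_mem (L.pow_mem hPL i) hr'L, mul_ne_zero (pow_ne_zero i hp0') hr'0⟩
  · obtain ⟨β, hβL, hβ0, hβ⟩ := hβ
    -- valuations: `|α| = |p|^v`, `|β| = |p|^u`, `(1 - e) v = p^m u`
    obtain ⟨v, hv⟩ := exists_val_eq_zpow w L ϖ hϖL hϖ1 hϖ0 hdisc hαL hα0
    obtain ⟨u, hu⟩ := exists_val_eq_zpow w L ϖ hϖL hϖ1 hϖ0 hdisc hβL hβ0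
    have hpne : w P ≠ 0 := hϖ0.ne'
    have hval : w P ^ ((1 - e) * v) = w P ^ (((p ^ m : ℕ) : ℤ) * u) := by
      have h := congrArg w hβ
      rw [map_mul, map_inv₀, map_zpow₀, hFw, hv, map_pow, hu, ← zpow_mul, ← zpow_neg, ← zpow_add₀ hpne,
        ← zpow_natCast, ← zpow_mul] at h
      convert h using 2 <;> ring
    have hdvd : ((p ^ m : ℕ) : ℤ) ∣ (e - 1) * v := by
      have h := zpow_val_injective w ϖ hϖ1 hϖ0 hval
      refine ⟨-u, ?_⟩
      linear_combination -h
    -- `v = p^m t + i`, `0 ≤ i < p^m`, `i ∈ I`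
    set t : ℤ := v / ((p ^ m : ℕ) : ℤ) with htdef
    set i : ℤ := v % ((p ^ m : ℕ) : ℤ) with hidef
    have hvi : v = ((p ^ m : ℕ) : ℤ) * t + i := by
      have := Int.emod_def v ((p ^ m : ℕ) : ℤ)
      rw [← hidef, ← htdef] at this
      linear_combination -this
    have hi0 : 0 ≤ i := Int.emod_nonneg _ hpm0
    have hilt : i < ((p ^ m : ℕ) : ℤ) := Int.emod_lt_of_pos _ (by exact_mod_cast pow_pos hprime.pos m)
    have hiI : i.toNat ∈ I := by
      rw [hIdef, Finset.mem_filter, Finset.mem_range]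
      refine ⟨by omega, ?_⟩
      rw [Int.toNat_of_nonneg hi0]
      have : (e - 1) * i = (e - 1) * v - ((p ^ m : ℕ) : ℤ) * ((e - 1) * t) := by rw [hvi]; ring
      rw [this]
      exact dvd_sub hdvd (dvd_mul_right _ _)
    -- the unit `ε = α p^{-v}`
    set ε : Ω := α * P ^ (-v) with hεdef
    have hεL : ε ∈ L := L.mul_mem hαL (L.zpow_mem hPL _)
    have hε : w ε = 1 := by
      rw [hεdef, map_mul, map_zpow₀, hv, ← zpow_add₀ hpne, add_neg_cancel, zpow_zero]
    -- its twist is a `p^m`-th power of a unit: `F ε ε^{-e} = (β p^s)^{p^m}`, `s = (e-1)v/p^m`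
    obtain ⟨s, hs⟩ := hdvd
    have hFP : F P = P := by rw [hPdef, hFϖ]
    have htwist : F ε * (ε ^ e)⁻¹ = (β * P ^ s) ^ p ^ m := by
      calc F ε * (ε ^ e)⁻¹ = (F α * (α ^ e)⁻¹) * (P ^ (-v) * (P ^ (-v * e))⁻¹) := by
            rw [hεdef, map_mul, map_zpow₀, hFP, mul_zpow, ← zpow_mul, mul_inv]; ring
        _ = β ^ p ^ m * P ^ (((p ^ m : ℕ) : ℤ) * s) := by
            rw [hβ, ← zpow_neg, ← zpow_add₀ hp0', show -v + -(-v * e) = (e - 1) * v by ring, hs]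
        _ = (β * P ^ s) ^ p ^ m := by
            rw [mul_pow, ← zpow_natCast (P ^ s), ← zpow_mul, mul_comm s]
    have hγ : ∃ γ ∈ L, w γ = 1 ∧ γ ^ p ^ m = F ε * (ε ^ e)⁻¹ := by
      refine ⟨β * P ^ s, L.mul_mem hβL (L.zpow_mem hPL s), ?_, htwist.symm⟩
      have h1 : w (F ε * (ε ^ e)⁻¹) = 1 := by
        rw [map_mul, map_inv₀, map_zpow₀, hFw, hε, one_zpow, inv_one, mul_one]
      rw [htwist, map_pow] at h1
      rcases lt_trichotomy (w (β * P ^ s)) 1 with hlt | heq | hgt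
      · exact absurd h1 (pow_lt_one₀ zero_le hlt (pow_ne_zero m hprime.ne_zero)).ne
      · exact heq
      · exact absurd h1 (one_lt_pow₀ hgt (pow_ne_zero m hprime.ne_zero)).ne'
    obtain ⟨r, hr, γ, hγL, hγ1, hγpow⟩ := hRcov ε hεL hε hγ
    obtain ⟨hrL, hr1⟩ := hR r hr
    have hr0 : r ≠ 0 := fun h ↦ by
      rw [h, zero_sub, Valuation.map_neg, map_one] at hr1; exact absurd hr1 (not_le.mpr hϖ1)
    have hγ0 : γ ≠ 0 := fun h ↦ by rw [h, map_zero] at hγ1; exact zero_ne_one hγ1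
    -- `α = (p^i r) · (γ p^t)^{p^m}`
    refine ⟨f (i.toNat, r), Finset.mem_image.mpr ⟨(i.toNat, r), Finset.mem_product.mpr ⟨hiI, hr⟩, rfl⟩,
      γ * P ^ t, L.mul_mem hγL (L.zpow_mem hPL t), mul_ne_zero hγ0 (zpow_ne_zero t hp0'), ?_⟩
    change α = P ^ i.toNat * r * (γ * P ^ t) ^ p ^ m
    have hα : α = ε * P ^ v := by
      rw [hεdef, mul_assoc, ← zpow_add₀ hp0', neg_add_cancel, zpow_zero, mul_one]
    rw [hα, mul_pow, hγpow, ← zpow_natCast (P ^ t), ← zpow_mul, ← zpow_natCast P i.toNat,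
      Int.toNat_of_nonneg hi0, hvi]
    rw [zpow_add₀ hp0']
    field_simp
    ring

end Count

end Literature.NumberTheory.EllipticCurves.TwistedKummerRamified
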